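import Summits.ResolutionOfSingularities.ResolutionOfSingularities.Theorems.EquisingularLiftEquisingularLiftNatConeDeltaPlaneChartsPresentation
import Summits.ResolutionOfSingularities.ResolutionOfSingularities.Theorems.EquisingularLiftEquisingularLiftNatPlaneChartLocalizationPointed
import HarnessLib

/-!
# [OURS · L1 W4.5(b) · EL♮(3)] (δ) D4 ring half — the POINTED cone-delta transport: `TCPlus.ConeDeltaRegular c′ Φ′` at a cone point from plane
# chart clauses that grant regularity only at the primes over the point (the output shape of (δ) D1 `exists_clusterConeLift_subset` at a
# point of a cluster) (crux `EquisingularLiftNatThree` stmt-ResolutionOfSingularities-20148 / parent 20038; rung v7′ TC⁺⁺, STEP 0 per subset)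

NOT a statement of any manuscript. Helper file of the chain res-L1-w45b (cell `res-hironaka`, LADDER-RESOLUTION rung L, slot W4.5(b));
OURS; AI-written, weaker than expert review; `--supports stmt-ResolutionOfSingularities-20148 --as helper` by res-L1-w45b-stub-3 (brick D4, ring
half, of `L/res-L1-w45b-stub-3/DELTA-PLAN.md`). No `sorry`; standard axioms. It closes nothing by itself.

WHAT. res-L1-w45b-stub-3's B7★ chain (p539780 `coneDeltaRegular_hcar_of_planeCharts` / `coneDeltaRegular_of_planeCharts`, p540595
`coneDeltaRegular_of_chartPresentation`) asks, in T-ΔLIFT-CENTRED's shape (p523916), that the local rings of `Λ[X,Y]/(Φu)`, `Λ[X,Y]/(Φv)`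
be regular at EVERY prime containing `C ϖ`. At a point of a CLUSTER the cone `Φ_S` of (δ) D1 (…NatClusterConeSubset) only has regular
strict transforms at the primes containing `C ϖ` AND the exceptional variable — the infinitely-near points of THAT cluster point — which is
all the cone point's `ConeDeltaRegular` ever visits (res-L1-w45b-stub-3 `isRegularLocalRing_quot_of_planeChart_over`, p541387). The three
theorems here are the B7★ chain VERBATIM with that pointed hypothesis:
* `coneDeltaRegular_hcar_of_planeCharts_over` (needs `X l ∈ 𝔫`, the chart coordinates lying over the point),
* `coneDeltaRegular_of_planeCharts_over` (`X l ∈ 𝔫` derived from `(c) + (ϖ_A) = 𝔪_A`),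
* **`coneDeltaRegular_of_chartPresentation_over`** — the B6c/D4 entry point in B1★ currency.

References: res-L1-w45b-stub-3 p539780, p540595, p541387; res-L1-w45b-stub-2 K8 (γ) p535712. U. Görtz, T. Wedhorn, *Algebraic Geometry I*
(2020), Prop. 13.96 (2) p. 416 [cite: GortzWedhorn2020]; H. Matsumura, *Commutative Ring Theory* (1986), Thm. 14.2 [cite: Matsumura1987].
-/

set_option linter.dupNamespace false -- mandated namespace `Summit.<Summit>.<Problem>` of this single-conjunct summit

noncomputable section

namespace Summit.ResolutionOfSingularities.ResolutionOfSingularities.Cruxes.EquisingularLiftNat.Sections.TCPlus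

open MvPolynomial IsLocalRing Literature.AlgebraicGeometry.Resolution
open Summit.ResolutionOfSingularities.ResolutionOfSingularities.Cruxes.EquisingularLiftNat.Sections

universe u

section Package

variable {A : Type u} [CommRing A] [IsLocalRing A] (c : Fin 3 → A) (Φ' : MvPolynomial (Fin 2) A)
  {Λ : Type u} [CommRing Λ] [IsDomain Λ] (ϖ : Λ)
  (ψ : MvPolynomial (Fin 2) Λ →+* A ⧸ Ideal.span ({c 0} : Set A)) (𝔫 : Ideal (MvPolynomial (Fin 2) Λ)) [𝔫.IsPrime]

/-- **B7★ POINTED — the (H-model) hypothesis of K8 (γ) from the plane chart clauses AT THE PRIMES OVER THE POINT ONLY.** As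
`coneDeltaRegular_hcar_of_planeCharts` (…NatConeDeltaPlaneCharts, p539780), but the regularity of the local rings of `Λ[X,Y]/(Φu)`,
`Λ[X,Y]/(Φv)` is only asked at the primes containing `C ϖ` AND the exceptional variable (`X 0` resp. `X 1`) — the primes over the centre of the
chart; enough because every prime the (H-model) visits lies over the point `𝔫 ∋ C ϖ, X 0, X 1` (res-L1-w45b-stub-3
`isRegularLocalRing_quot_of_planeChart_over`, p541387). This is the shape delivered at a point of a CLUSTER by (δ) D1
(`exists_clusterConeLift_subset`), where regularity off the exceptional line is neither available nor needed.
[cite: GortzWedhorn2020, Prop. 13.96 (2) p. 416] [OURS · L1 W4.5b] (δ) D4; NOT a statement of the manuscript. -/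
theorem coneDeltaRegular_hcar_of_planeCharts_over (hloc : @IsLocalization.AtPrime _ _ (A ⧸ Ideal.span ({c 0} : Set A)) _ ψ.toAlgebra 𝔫 _)
    (hϖ : MvPolynomial.C ϖ ∈ 𝔫) (hX𝔫 : ∀ l : Fin 2, (X l : MvPolynomial (Fin 2) Λ) ∈ 𝔫)
    (hψ : ∀ l : Fin 2, ψ (X l) = Ideal.Quotient.mk (Ideal.span ({c 0} : Set A)) (c l.succ))
    {m : ℕ} (hΦ'd : Φ'.IsHomogeneous m) (Φ : MvPolynomial (Fin 3) Λ) (Φu Φv : MvPolynomial (Fin 2) Λ)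
    (hΦu : MvPolynomial.aeval (![1, X 0, X 0 * X 1] : Fin 3 → MvPolynomial (Fin 2) Λ) Φ = X 0 ^ m * Φu)
    (hΦv : MvPolynomial.aeval (![1, X 0 * X 1, X 1] : Fin 3 → MvPolynomial (Fin 2) Λ) Φ = X 1 ^ m * Φv)
    (hΦ' : Ideal.Quotient.mk (Ideal.span ({c 0} : Set A)) (MvPolynomial.eval (fun l : Fin 2 => c l.succ) Φ') =
      ψ (MvPolynomial.aeval (![1, X 0, X 1] : Fin 3 → MvPolynomial (Fin 2) Λ) Φ))
    (hregu : ∀ (Q : Ideal (MvPolynomial (Fin 2) Λ ⧸ Ideal.span {Φu})) [Q.IsPrime],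
      Ideal.Quotient.mk (Ideal.span {Φu}) (MvPolynomial.C ϖ) ∈ Q →
      Ideal.Quotient.mk (Ideal.span {Φu}) (X 0 : MvPolynomial (Fin 2) Λ) ∈ Q → IsRegularLocalRing (Localization.AtPrime Q))
    (hregv : ∀ (Q : Ideal (MvPolynomial (Fin 2) Λ ⧸ Ideal.span {Φv})) [Q.IsPrime],
      Ideal.Quotient.mk (Ideal.span {Φv}) (MvPolynomial.C ϖ) ∈ Q →
      Ideal.Quotient.mk (Ideal.span {Φv}) (X 1 : MvPolynomial (Fin 2) Λ) ∈ Q → IsRegularLocalRing (Localization.AtPrime Q)) :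
    ∀ (j' : Fin 2)
      (𝔮 : Ideal (blowupAlgebra (Ideal.span (Set.range fun l : Fin 2 => Ideal.Quotient.mk (Ideal.span {c 0}) (c l.succ)))
        ((fun l : Fin 2 => Ideal.Quotient.mk (Ideal.span {c 0}) (c l.succ)) j'))) [𝔮.IsPrime],
      𝔮.comap ((algebraMap (A ⧸ Ideal.span {c 0}) _).comp (Ideal.Quotient.mk (Ideal.span {c 0}))) = maximalIdeal A →
      MvPolynomial.aeval (blowupAlgebra.frac (fun l : Fin 2 => Ideal.Quotient.mk (Ideal.span {c 0}) (c l.succ)) j')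
          (MvPolynomial.map (Ideal.Quotient.mk (Ideal.span {c 0})) Φ') ∈ 𝔮 →
      ∀ (T : Type u) [CommRing T]
        [Algebra (blowupAlgebra (Ideal.span (Set.range fun l : Fin 2 => Ideal.Quotient.mk (Ideal.span {c 0}) (c l.succ)))
          ((fun l : Fin 2 => Ideal.Quotient.mk (Ideal.span {c 0}) (c l.succ)) j')) T] [IsLocalization.AtPrime T 𝔮],
        IsRegularLocalRing (T ⧸ Ideal.span {algebraMap _ T
          (MvPolynomial.aeval (blowupAlgebra.frac (fun l : Fin 2 => Ideal.Quotient.mk (Ideal.span {c 0}) (c l.succ)) j')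
            (MvPolynomial.map (Ideal.Quotient.mk (Ideal.span {c 0})) Φ'))}) := by
  classical
  haveI : IsLocalRing (A ⧸ Ideal.span ({c 0} : Set A)) := planeChart_loc_isLocalRing ψ 𝔫 hloc
  intro j' 𝔮 _ h𝔮 hmem T _ _ _
  -- `𝔮` lies over the maximal ideal of the carrier
  have h𝔮' : 𝔮.comap (algebraMap (A ⧸ Ideal.span ({c 0} : Set A)) _) = maximalIdeal (A ⧸ Ideal.span ({c 0} : Set A)) := by
    have h1 : 𝔮.comap (algebraMap (A ⧸ Ideal.span ({c 0} : Set A)) _) =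
        (maximalIdeal A).map (Ideal.Quotient.mk (Ideal.span ({c 0} : Set A))) := by
      rw [← h𝔮, ← Ideal.comap_comap, Ideal.map_comap_of_surjective _ Ideal.Quotient.mk_surjective]
    rcases Ideal.map_eq_top_or_isMaximal_of_surjective (Ideal.Quotient.mk (Ideal.span ({c 0} : Set A)))
      Ideal.Quotient.mk_surjective (IsLocalRing.maximalIdeal.isMaximal A) with htop | hmax
    · exact absurd (h1.trans htop) (Ideal.IsPrime.ne_top inferInstance)
    · rw [h1]
      exact IsLocalRing.eq_maximalIdeal hmax
  have hF : MvPolynomial.eval (fun l : Fin 2 => Ideal.Quotient.mk (Ideal.span ({c 0} : Set A)) (c l.succ))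
      (MvPolynomial.map (Ideal.Quotient.mk (Ideal.span ({c 0} : Set A))) Φ') =
      ψ (MvPolynomial.aeval (![1, X 0, X 1] : Fin 3 → MvPolynomial (Fin 2) Λ) Φ) := by
    rw [eval_map_mk_tail, hΦ']
  -- a prime over the point `𝔫` contains `C ϖ` and `X_j`
  have hover : ∀ (j : Fin 2) (F : MvPolynomial (Fin 2) Λ) (Q : Ideal (MvPolynomial (Fin 2) Λ ⧸ Ideal.span {F})),
      (Q.comap (Ideal.Quotient.mk (Ideal.span {F}))).comap
        (MvPolynomial.aeval (R := Λ) fun l : Fin 2 =>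
          if l = j then (X j : MvPolynomial (Fin 2) Λ) else X j * X l).toRingHom = 𝔫 →
      Ideal.Quotient.mk (Ideal.span {F}) (MvPolynomial.C ϖ) ∈ Q ∧
        Ideal.Quotient.mk (Ideal.span {F}) (X j : MvPolynomial (Fin 2) Λ) ∈ Q := by
    intro j F Q hQ
    have h1 : MvPolynomial.C ϖ ∈ (Q.comap (Ideal.Quotient.mk (Ideal.span {F}))).comap
        (MvPolynomial.aeval (R := Λ) fun l : Fin 2 =>
          if l = j then (X j : MvPolynomial (Fin 2) Λ) else X j * X l).toRingHom := by rw [hQ]; exact hϖ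
    have h2 : (X j : MvPolynomial (Fin 2) Λ) ∈ (Q.comap (Ideal.Quotient.mk (Ideal.span {F}))).comap
        (MvPolynomial.aeval (R := Λ) fun l : Fin 2 =>
          if l = j then (X j : MvPolynomial (Fin 2) Λ) else X j * X l).toRingHom := by rw [hQ]; exact hX𝔫 j
    rw [Ideal.mem_comap, Ideal.mem_comap, AlgHom.toRingHom_eq_coe, RingHom.coe_coe, MvPolynomial.algHom_C,
      MvPolynomial.algebraMap_eq] at h1
    rw [Ideal.mem_comap, Ideal.mem_comap, AlgHom.toRingHom_eq_coe, RingHom.coe_coe, MvPolynomial.aeval_X, if_pos rfl] at h2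
    exact ⟨h1, h2⟩
  have hj' : j' = 0 ∨ j' = 1 := by fin_cases j' <;> simp
  rcases hj' with rfl | rfl
  · refine isRegularLocalRing_quot_of_planeChart_over ψ 𝔫 _ 0 hloc hψ _ (hΦ'd.map _) _ Φu hF ?_
      (fun Q _ hQ => hregu Q (hover 0 Φu Q hQ).1 (hover 0 Φu Q hQ).2) 𝔮 h𝔮' hmem T
    rw [aeval_subst_zero_aeval_dehom, hΦu]
  · refine isRegularLocalRing_quot_of_planeChart_over ψ 𝔫 _ 1 hloc hψ _ (hΦ'd.map _) _ Φv hF ?_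
      (fun Q _ hQ => hregv Q (hover 1 Φv Q hQ).1 (hover 1 Φv Q hQ).2) 𝔮 h𝔮' hmem T
    rw [aeval_subst_one_aeval_dehom, hΦv]


/-- **B7★ POINTED — `TCPlus.ConeDeltaRegular c Φ′` from the plane chart clauses at the primes over the point** (as
`coneDeltaRegular_of_planeCharts`, p539780, with the pointed regularity hypotheses; `X l ∈ 𝔫` is automatic from `(c) + (ϖ_A) = 𝔪_A`).
[cite: Matsumura1987, Thm. 14.2] [OURS · L1 W4.5b] (δ) D4; NOT a statement of the manuscript. -/
theorem coneDeltaRegular_of_planeCharts_over [IsNoetherianRing A] (ϖA : A)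
    (h𝔪 : Ideal.span (Set.range c) ⊔ Ideal.span {ϖA} = maximalIdeal A) (hdim : ringKrullDim A = (2 + 2 : ℕ))
    {m : ℕ} (hΦ'd : Φ'.IsHomogeneous m) (hΦ'𝔪 : MvPolynomial.map (IsLocalRing.residue A) Φ' ≠ 0)
    (hloc : @IsLocalization.AtPrime _ _ (A ⧸ Ideal.span ({c 0} : Set A)) _ ψ.toAlgebra 𝔫 _)
    (hϖ : MvPolynomial.C ϖ ∈ 𝔫) (hψ : ∀ l : Fin 2, ψ (X l) = Ideal.Quotient.mk (Ideal.span ({c 0} : Set A)) (c l.succ))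
    (Φ : MvPolynomial (Fin 3) Λ) (Φu Φv : MvPolynomial (Fin 2) Λ)
    (hΦu : MvPolynomial.aeval (![1, X 0, X 0 * X 1] : Fin 3 → MvPolynomial (Fin 2) Λ) Φ = X 0 ^ m * Φu)
    (hΦv : MvPolynomial.aeval (![1, X 0 * X 1, X 1] : Fin 3 → MvPolynomial (Fin 2) Λ) Φ = X 1 ^ m * Φv)
    (hΦ' : Ideal.Quotient.mk (Ideal.span ({c 0} : Set A)) (MvPolynomial.eval (fun l : Fin 2 => c l.succ) Φ') =
      ψ (MvPolynomial.aeval (![1, X 0, X 1] : Fin 3 → MvPolynomial (Fin 2) Λ) Φ))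
    (hregu : ∀ (Q : Ideal (MvPolynomial (Fin 2) Λ ⧸ Ideal.span {Φu})) [Q.IsPrime],
      Ideal.Quotient.mk (Ideal.span {Φu}) (MvPolynomial.C ϖ) ∈ Q →
      Ideal.Quotient.mk (Ideal.span {Φu}) (X 0 : MvPolynomial (Fin 2) Λ) ∈ Q → IsRegularLocalRing (Localization.AtPrime Q))
    (hregv : ∀ (Q : Ideal (MvPolynomial (Fin 2) Λ ⧸ Ideal.span {Φv})) [Q.IsPrime],
      Ideal.Quotient.mk (Ideal.span {Φv}) (MvPolynomial.C ϖ) ∈ Q →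
      Ideal.Quotient.mk (Ideal.span {Φv}) (X 1 : MvPolynomial (Fin 2) Λ) ∈ Q → IsRegularLocalRing (Localization.AtPrime Q)) :
    ConeDeltaRegular c Φ' := by
  -- the chart coordinates lie over the point: `X l ∈ 𝔫` since `ψ (X l) = c̄_{l+1} ∈ 𝔪`
  haveI : IsLocalRing (A ⧸ Ideal.span ({c 0} : Set A)) := planeChart_loc_isLocalRing ψ 𝔫 hloc
  have hX𝔫 : ∀ l : Fin 2, (X l : MvPolynomial (Fin 2) Λ) ∈ 𝔫 := by
    intro l
    rw [← planeChart_loc_mem_maximalIdeal_iff ψ 𝔫 hloc, hψ]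
    haveI := IsLocalHom.of_surjective (Ideal.Quotient.mk (Ideal.span ({c 0} : Set A))) Ideal.Quotient.mk_surjective
    refine map_nonunit (Ideal.Quotient.mk (Ideal.span ({c 0} : Set A))) (c l.succ) ?_
    rw [← h𝔪]
    exact Ideal.mem_sup_left (Ideal.subset_span (Set.mem_range_self _))
  exact coneDeltaRegular_of_carrier_of_rsop c Φ' ϖA h𝔪 hdim hΦ'd hΦ'𝔪
    (coneDeltaRegular_hcar_of_planeCharts_over c Φ' ϖ ψ 𝔫 hloc hϖ hX𝔫 hψ hΦ'd Φ Φu Φv hΦu hΦv hΦ' hregu hregv)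


end Package

section ConePoint

/-- **B7★ POINTED, end to end — `TCPlus.ConeDeltaRegular c′ Φ′` at the cone point from the chart-0 presentation and the plane chart
clauses at the primes over the point** (as `coneDeltaRegular_of_chartPresentation`, p540595, with the pointed regularity hypotheses — the
currency of (δ) D1 `exists_clusterConeLift_subset` at a cluster point). [cite: Matsumura1987, Thm. 14.2] [OURS · L1 W4.5b] (δ) D4;
NOT a statement of the manuscript. -/
theorem coneDeltaRegular_of_chartPresentation_over
    {R : Type u} [CommRing R] [IsLocalRing R] (c : Fin 3 → R) (hc : IsQuasiRegular c)
    {Λ : Type u} [CommRing Λ] [IsDomain Λ] (θ : (R ⧸ Ideal.span (Set.range c)) ≃+* Λ)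
    {A : Type u} [CommRing A] [IsLocalRing A] [IsNoetherianRing A]
    (χ : blowupAlgebra (Ideal.span (Set.range c)) (c 0) →+* A)
    (𝔔₀ : Ideal (blowupAlgebra (Ideal.span (Set.range c)) (c 0))) [𝔔₀.IsPrime]
    (hlocA : @IsLocalization.AtPrime _ _ A _ χ.toAlgebra 𝔔₀ _)
    (h𝔔₀ : 𝔔₀.comap (algebraMap R _) = maximalIdeal R)
    (c' : Fin 3 → A) (hc'0 : c' 0 = χ (algebraMap R _ (c 0)))
    (hc'succ : ∀ l : Fin 2, c' l.succ = χ (blowupAlgebra.frac c 0 l.succ))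
    (ϖA : A) (h𝔪 : Ideal.span (Set.range c') ⊔ Ideal.span {ϖA} = maximalIdeal A) (hdim : ringKrullDim A = (2 + 2 : ℕ))
    (Φ' : MvPolynomial (Fin 2) A) {m : ℕ} (hΦ'd : Φ'.IsHomogeneous m)
    (hΦ'𝔪 : MvPolynomial.map (IsLocalRing.residue A) Φ' ≠ 0)
    (ΦR : MvPolynomial (Fin 3) R) (Φ : MvPolynomial (Fin 3) Λ)
    (hΦR : MvPolynomial.map (θ.toRingHom.comp (Ideal.Quotient.mk (Ideal.span (Set.range c)))) ΦR = Φ)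
    (hΦ' : Ideal.Quotient.mk (Ideal.span ({c' 0} : Set A)) (MvPolynomial.eval (fun l : Fin 2 => c' l.succ) Φ') =
      Ideal.Quotient.mk (Ideal.span ({c' 0} : Set A)) (χ (MvPolynomial.aeval (blowupAlgebra.frac c 0) ΦR)))
    (ϖR : R) (hϖR : ϖR ∈ maximalIdeal R) (ϖ : Λ) (hϖ : θ (Ideal.Quotient.mk (Ideal.span (Set.range c)) ϖR) = ϖ)
    (Φu Φv : MvPolynomial (Fin 2) Λ)
    (hΦu : MvPolynomial.aeval (![1, X 0, X 0 * X 1] : Fin 3 → MvPolynomial (Fin 2) Λ) Φ = X 0 ^ m * Φu)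
    (hΦv : MvPolynomial.aeval (![1, X 0 * X 1, X 1] : Fin 3 → MvPolynomial (Fin 2) Λ) Φ = X 1 ^ m * Φv)
    (hregu : ∀ (Q : Ideal (MvPolynomial (Fin 2) Λ ⧸ Ideal.span {Φu})) [Q.IsPrime],
      Ideal.Quotient.mk (Ideal.span {Φu}) (MvPolynomial.C ϖ) ∈ Q →
      Ideal.Quotient.mk (Ideal.span {Φu}) (X 0 : MvPolynomial (Fin 2) Λ) ∈ Q → IsRegularLocalRing (Localization.AtPrime Q))
    (hregv : ∀ (Q : Ideal (MvPolynomial (Fin 2) Λ ⧸ Ideal.span {Φv})) [Q.IsPrime],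
      Ideal.Quotient.mk (Ideal.span {Φv}) (MvPolynomial.C ϖ) ∈ Q →
      Ideal.Quotient.mk (Ideal.span {Φv}) (X 1 : MvPolynomial (Fin 2) Λ) ∈ Q → IsRegularLocalRing (Localization.AtPrime Q)) :
    ConeDeltaRegular c' Φ' := by
  classical
  obtain ⟨Θ, hΘsurj, hΘker, hΘC, hΘX⟩ := exists_chartZero_quotient_hom c θ hc
  have hc0𝔔 : algebraMap R (blowupAlgebra (Ideal.span (Set.range c)) (c 0)) (c 0) ∈ 𝔔₀ := by
    rw [← Ideal.mem_comap, h𝔔₀]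
    exact span_range_le_maximalIdeal_of_equiv c θ (Ideal.subset_span (Set.mem_range_self 0))
  obtain ⟨ψ, 𝔫, hloc, hψΘ, hmem⟩ := exists_carrierPresentation_of_chart χ 𝔔₀ hlocA Θ hΘsurj hΘker hc0𝔔 hc'0
  -- the cone germ reduces to `Φ(1, U₁, U₂)`
  have hf : Θ.comp (algebraMap R (blowupAlgebra (Ideal.span (Set.range c)) (c 0))) =
      (algebraMap Λ (MvPolynomial (Fin 2) Λ)).comp (θ.toRingHom.comp (Ideal.Quotient.mk (Ideal.span (Set.range c)))) :=
    RingHom.ext fun r => by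
      simp only [RingHom.comp_apply, hΘC, MvPolynomial.algebraMap_eq]
      rfl
  have hg : (fun i => Θ (blowupAlgebra.frac c 0 i)) = (![1, X 0, X 1] : Fin 3 → MvPolynomial (Fin 2) Λ) := by
    funext i
    refine Fin.cases ?_ (fun l => ?_) i
    · rw [show blowupAlgebra.frac c 0 0 = 1 from blowupAlgebra.gen_self _ _ _, map_one]
      rfl
    · rw [hΘX]
      have hl : l = 0 ∨ l = 1 := by fin_cases l <;> simp
      rcases hl with rfl | rfl <;> rfl
  have hΘcone : Θ (MvPolynomial.aeval (blowupAlgebra.frac c 0) ΦR) =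
      MvPolynomial.aeval (![1, X 0, X 1] : Fin 3 → MvPolynomial (Fin 2) Λ) Φ := by
    rw [MvPolynomial.map_aeval, hf, hg, ← hΦR, MvPolynomial.aeval_def, MvPolynomial.eval₂_map]
    rfl
  refine coneDeltaRegular_of_planeCharts_over c' Φ' ϖ ψ 𝔫.asIdeal ϖA h𝔪 hdim hΦ'd hΦ'𝔪 hloc ?_ ?_ Φ Φu Φv hΦu hΦv ?_ hregu
    hregv
  · -- `C ϖ ∈ 𝔫`
    rw [← hϖ, ← hΘC, hmem]
    letI := χ.toAlgebra
    haveI := hlocA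
    exact (IsLocalization.AtPrime.to_map_mem_maximal_iff A 𝔔₀ _).mpr (by rw [← Ideal.mem_comap, h𝔔₀]; exact hϖR)
  · intro l
    rw [← hΘX, hψΘ, hc'succ]
  · rw [hΦ', ← hψΘ, hΘcone]

end ConePoint

end Summit.ResolutionOfSingularities.ResolutionOfSingularities.Cruxes.EquisingularLiftNat.Sections.TCPlus

end
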